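import Mathlib
import HarnessLib
import Summits.HubbardSuperconductivity.HubbardSuperconductivity.Theorems.KLProgrammeKLRegimeEngineScaleZeroValCPackage

/-!
# The scale-0 rung of the K3 engine, assembled modulo (E4)₀ and the isotropic torus bound

Glue for `stub_engine_scale0` of `KLRegimeEngineV14` (item stmt-HubbardSuperconductivity-19918, package
`klEngGeo3 / klEngQ5 P R / klEngC₃3 / klEngU₀3 / klEngL₃ / klEngM₃`): the stub's five-clause conjunction
`KernelNormsV4 … 0 ∧ PairLadderStepAtV9 … 0 ∧ QuarticValueUVAtS2 … 0 ∧ EngineFirstMoments … 0 ∧ IsoTupleL1AtS … 0`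
under EXACTLY the stub's binders, from the two inputs that are not yet in the tree:

* `hE4 : EngineFirstMoments L M G P (klEngQ5 P R) β U μ K 0` — the first-moment clause (E4)₀ (k3c2-p1's lane);
* `hT` — ONE uniform torus `ℓ¹` bound `Th / imagTimeWeight β M` for the character sums of every isotropic sector
  multiplier `klIsoFamily … m ω` on the `(ℤ/4M) × (ℤ/L)²` grid (the isotropic sector lemma, p4's lane), together with
  `hCF : Th ^ 4 ≤ G.CF` (the package inequality; at `klEngGeo3` it reads `Th ^ 4 ≤ 2 ^ 52`, at a successor package with
  `CF := max … (Th ^ 4)` it is `le_max_right`).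

Everything else — (E1-v4)₀ (`kernelNormsV4_zero_of_klEng_of_le_CE`, k3c2-p1), the values conjuncts (E2-v9).1 and
(E2′-S2 UV) (`pairLadderStepAtV8_zero_of_klEng`, p3), (E5-S)₀ (`isoTupleL1AtS_zero_of_klEngU₀3`, p3), and the two
`U`-smallnesses `klScaleZeroThetaC R · U ≤ 1/2`, `klScaleZeroValC R · U ≤ 1/4` under `U ≤ klEngU₀3 P R c` — is discharged
here by name.  The `G`-parametric form `engineScaleZero_klEngQ5_of` needs only `G.WF`; `engineScaleZero_klEngGeo3_of` is its
specialisation to the package of record.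
-/

namespace Summit.HubbardSuperconductivity.HubbardSuperconductivity.Theorems.EngineV8

noncomputable section

open Real Finset Literature.MathematicalPhysics.QuantumLattice Literature.Probability.LatticeModels
open Summit.HubbardSuperconductivity.HubbardSuperconductivity.Theorems.KLRegimeSplit
open Summit.HubbardSuperconductivity.HubbardSuperconductivity.Theorems.KLProgrammeLegKernels
open scoped ComplexConjugate

/-- **Scale-0 rung at `klEngQ5`, `G`-parametric, modulo (E4)₀ and the isotropic torus bound.**  For any well-formed
geometric package `G`, under exactly the binders of `stub_engine_scale0` (with `G` in place of `klEngGeo3`), the (E4)₀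
clause `hE4`, a uniform torus bound `hT` for the isotropic sector multipliers with constant `Th ≥ 0`, and the package
inequality `Th ^ 4 ≤ G.CF`, the five-clause scale-0 conjunction holds. -/
theorem engineScaleZero_klEngQ5_of (G : GeoConsts) (hG : G.WF) (P : SplitConsts) (R : RenConsts) (c : ℝ) (hP : P.WF)
    (hR : R.WF2) (hc : 0 < c) (hc₃ : c ≤ klEngC₃3 P R) (μ : ℝ) (hμ : μ ∈ klWindowC) (U : ℝ) (hU : 0 < U)
    (hU₀ : U ≤ klEngU₀3 P R c) (β : ℝ) (hβ : klBetaMin ≤ β) (hβc : β ≤ Real.exp (c / U ^ 2)) (K : TrigPolyC4v)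
    (hK : FrameOK R U (nScales β) μ K) (L M : ℕ) [NeZero L] [NeZero M] (hL : klEngL₃ β U ≤ L) (hM : klEngM₃ β U L ≤ M)
    (hE4 : EngineFirstMoments L M G P (klEngQ5 P R) β U μ K 0) {Th : ℝ} (hTh0 : 0 ≤ Th)
    (hT : ∀ (m : ℕ) (ω : Fin (sectorCount (2 * m))) (c' : Fin 2), 1 / (|β| * (L : ℝ) ^ 2) *
        ∑ dw : TorusSite 1 (2 * (2 * M)) × TorusSite 2 L, ‖∑ k : FreqMomentum L M, klIsoFamily L M β μ K klE0 m ω k *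
          (if c' = 0 then torusChar (fun _ : Fin 1 => ((k.1 : ℕ) : ZMod (2 * (2 * M)))) dw.1 * torusChar k.2 dw.2
            else conj (torusChar (fun _ : Fin 1 => ((k.1 : ℕ) : ZMod (2 * (2 * M)))) dw.1 * torusChar k.2 dw.2))‖ ≤
        Th / imagTimeWeight β M)
    (hCF : Th ^ 4 ≤ G.CF) :
    KernelNormsV4 L M P (klEngQ5 P R) β U μ K 0 ∧ PairLadderStepAtV9 L M G P (klEngQ5 P R) β U μ K 0 ∧
      QuarticValueUVAtS2 L M G P (klEngQ5 P R) β U μ K 0 ∧ EngineFirstMoments L M G P (klEngQ5 P R) β U μ K 0 ∧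
        IsoTupleL1AtS L M G P β U μ K 0 := by
  have _ := hc; have _ := hc₃; have _ := hβc
  obtain ⟨hE2, hUV⟩ := pairLadderStepAtV8_zero_of_klEng (L := L) (M := M) (G := G) (Q := klEngQ5 P R) hG hP
    (klEngQ5_wf P R) hR.wf hU (le_one_of_le_klEngU₀3 hU₀) hβ hK hL hM
    (klScaleZeroThetaC_mul_le_half_of_le_klEngU₀3 hR.wf hU hU₀) (klScaleZeroValC_le_four_mul_klEngQ5_CR hP.1 R)
  exact ⟨kernelNormsV4_zero_of_klEng_of_le_CE hR.wf (lt_of_lt_of_le one_pos hP.1) hU (le_one_of_le_klEngU₀3 hU₀) hU₀ hK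
      hμ hβ hL hM (klE1CE_le_klEngQ5_CE P R),
    (pairLadderStepAtV9_iff_V8_zero G P (klEngQ5 P R) β U μ K).2 hE2, hUV, hE4,
    isoTupleL1AtS_zero_of_klEngU₀3 hR.wf hU hU₀ hβ hK hL hM hTh0 hT hCF⟩

/-- **Scale-0 rung of `stub_engine_scale0` at the package of record `klEngGeo3 / klEngQ5`, modulo (E4)₀ and the isotropic
torus bound** — the literal five-clause conclusion of the registered stub, from `hE4`, `hT` (constant `Th ≥ 0`) and
`Th ^ 4 ≤ klEngGeo3.CF`. -/
theorem engineScaleZero_klEngGeo3_of (P : SplitConsts) (R : RenConsts) (c : ℝ) (hP : P.WF) (hR : R.WF2) (hc : 0 < c)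
    (hc₃ : c ≤ klEngC₃3 P R) (μ : ℝ) (hμ : μ ∈ klWindowC) (U : ℝ) (hU : 0 < U) (hU₀ : U ≤ klEngU₀3 P R c) (β : ℝ)
    (hβ : klBetaMin ≤ β) (hβc : β ≤ Real.exp (c / U ^ 2)) (K : TrigPolyC4v) (hK : FrameOK R U (nScales β) μ K) (L M : ℕ)
    [NeZero L] [NeZero M] (hL : klEngL₃ β U ≤ L) (hM : klEngM₃ β U L ≤ M)
    (hE4 : EngineFirstMoments L M klEngGeo3 P (klEngQ5 P R) β U μ K 0) {Th : ℝ} (hTh0 : 0 ≤ Th)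
    (hT : ∀ (m : ℕ) (ω : Fin (sectorCount (2 * m))) (c' : Fin 2), 1 / (|β| * (L : ℝ) ^ 2) *
        ∑ dw : TorusSite 1 (2 * (2 * M)) × TorusSite 2 L, ‖∑ k : FreqMomentum L M, klIsoFamily L M β μ K klE0 m ω k *
          (if c' = 0 then torusChar (fun _ : Fin 1 => ((k.1 : ℕ) : ZMod (2 * (2 * M)))) dw.1 * torusChar k.2 dw.2
            else conj (torusChar (fun _ : Fin 1 => ((k.1 : ℕ) : ZMod (2 * (2 * M)))) dw.1 * torusChar k.2 dw.2))‖ ≤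
        Th / imagTimeWeight β M)
    (hCF : Th ^ 4 ≤ klEngGeo3.CF) :
    KernelNormsV4 L M P (klEngQ5 P R) β U μ K 0 ∧ PairLadderStepAtV9 L M klEngGeo3 P (klEngQ5 P R) β U μ K 0 ∧
      QuarticValueUVAtS2 L M klEngGeo3 P (klEngQ5 P R) β U μ K 0 ∧
        EngineFirstMoments L M klEngGeo3 P (klEngQ5 P R) β U μ K 0 ∧ IsoTupleL1AtS L M klEngGeo3 P β U μ K 0 :=
  engineScaleZero_klEngQ5_of klEngGeo3 klEngGeo3_wf P R c hP hR hc hc₃ μ hμ U hU hU₀ β hβ hβc K hK L M hL hM hE4 hTh0 hT hCF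

end

end Summit.HubbardSuperconductivity.HubbardSuperconductivity.Theorems.EngineV8
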